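import Summits.HubbardSuperconductivity.HubbardLadder.Bounds.CurrentOperatorTTPrime
import Summits.HubbardSuperconductivity.HubbardLadder.Bounds.ThermalKuboCurvature
import HarnessLib

/-!
# Hubbard ladder — Bounds: the Kubo-curvature (thermal current-moment) stiffness ceiling,
# part 2 of 2 — the `t–t'` Hubbard torus in its canonical sectors

HONEST FRAMING (cell pub-hubbard): ladder R1–R4 with certified numbers; no claim on H/H₀. This is
a bound for a MODEL CLASS (the `t–t'` Hubbard torus `hubbardTorusTT' L 1 t' U` on `(ℤ/L)²`,
`L ≥ 3`, every `t'`, `U`, every coordinate sector, every `β > 0`), no materials claim. Companion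
text: `pub-hubbard/paper/bounds.tex` Thm 5′ ("thermal current moments"); table
`pub-hubbard/pub-hubbard-bounds/BOUNDS.md` row T1g. Part 1 (`ThermalKuboCurvature.lean`) is the
finite-dimensional engine; the `T = 0` companion is `StiffnessCeilingCurrentMoments.lean`.

## What is proved here (no `sorry`, no new axioms)

Let `H = hubbardTorusTT' L 1 t' U`, `K = kinOpTT' L t'` (`Re⟨χ,Kχ⟩ = 2(K_x + t'K_d)(χ)`),
`J = curOpTT' L t'` (`Re⟨χ,Jχ⟩ = 2(J_x + t'J_d)(χ)`, `CurrentOperatorTTPrime.lean`), `p` a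
coordinate sector, `H_p, K_p, J_p` the blocks, `⟨·⟩ = ⟨·⟩_{β,p}` the sector Gibbs state of `H_p`.

* `uniformTwistTT'_eq_add_smul` — the uniform twist is an OPERATOR identity,
  `uniformTwistTT' L t' U θ = H + (1 − cos(θ/L)) K + sin(θ/L) J` (`L ≥ 3`): the difference is
  Hermitian with vanishing quadratic form (`re_uniformTwistTT'_eq_kin_cur`), hence `0`.
* `ThermalCurrentMomentStiffnessCeilingTT'` (`@[conjecture] def`, PROVED by
  `thermalCurrentMomentStiffnessCeilingTT'_holds` from `thermalStiffnessTT'_le_kin_sub_duhamel`):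
  under the SAME hypothesis as the tree's kinetic bound `thermalStiffnessTT'_mul_sq_le_kinetic`
  — `β ρ_s θ² ≤ log Z_p(0) − log Z_p(θ)` for `|θ| ≤ θ₀`, `Z_p(θ)` the sector partition function of
  `hubbardTorusTT'Flux L t' U θ` — one has `Re⟨J_p⟩ = 0` and

    `ρ_s L² ≤ ½ Re⟨K_p⟩ − (β/2) Re (J_p, J_p)_Duh`,  `(J_p, J_p)_Duh = duhamel β H_p J_p J_p ≥ 0`:

  the kinetic bound minus the paramagnetic current susceptibility (finite-volume Kubo formula as
  a ceiling). No sign hypothesis on `ρ_s`; the empty sector is covered (all terms vanish).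
  Proof: gauge to the uniform twist (`partitionFn_toBlock_uniformTwistTT'_eq`), restrict the
  operator identity to the block, and apply part 1 with `c = 1/L`.
* `ThermalCurrentMomentFalkBruchCeilingTT'` (PROVED by `…_holds`): the same ceiling packaged with
  the tree's Falk–Bruch / Dyson–Lieb–Simon inequality for the single observable `J_p`
  (`re_gibbsState_mul_self_le_falkBruch`, from `falkBruch_sum_le`):
  `Re⟨J_p²⟩ ≤ b + ½ √(β b c)` with `b = Re (J_p,J_p)_Duh ≥ 0`, `c = Re⟨[J_p,[H_p,J_p]]⟩ ≥ 0`,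
  so that `b` is bounded BELOW by Gibbs MOMENTS of the current; solving the quadratic
  inequality in `√b` (text, Thm 5′) turns the ceiling into
  `ρ_s L² ≤ ½⟨K_p⟩ − (β/2) b_*(⟨J_p²⟩, c)`.

References (keys of `lean/references.bib`): ScalapinoWhiteZhang1993 §II; DLS1978 Thm. 3.1,
Cor. 3.2; HazraVermaRanderia2019 eq. (2); ParamekantiTrivediRanderia1998 eq. (3), §IV;
Watanabe2019 §2.2.3 (uniform gauge).
-/

noncomputable section

namespace Summit.HubbardSuperconductivity.HubbardLadder.Bounds

open Matrix Finset
open Literature.MathematicalPhysics.QuantumLattice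
open Literature.MathematicalPhysics.QuantumFieldTheory
open Literature.Probability.LatticeModels
open scoped ComplexOrder ComplexConjugate

/-! ### The uniform twist as an operator identity -/

section Operator

variable {L : ℕ} [NeZero L]

/-- **The uniform twist is `H + (1 − cos(θ/L)) K + sin(θ/L) J` as an operator** (`L ≥ 3`): the
difference is Hermitian and its quadratic form vanishes identically
(`re_uniformTwistTT'_eq_kin_cur`), so it is both positive and negative semidefinite, hence has
trace `0`, hence is `0`. [cite: Watanabe2019, §2.2.3] -/
theorem uniformTwistTT'_eq_add_smul (hL : 3 ≤ L) (t' U θ : ℝ) :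
    uniformTwistTT' L t' U θ = hubbardTorusTT' L 1 t' U +
      ((1 - Real.cos (θ / L) : ℝ) : ℂ) • kinOpTT' L t' +
      ((Real.sin (θ / L) : ℝ) : ℂ) • curOpTT' L t' := by
  set D := uniformTwistTT' L t' U θ - hubbardTorusTT' L 1 t' U -
      ((1 - Real.cos (θ / L) : ℝ) : ℂ) • kinOpTT' L t' -
      ((Real.sin (θ / L) : ℝ) : ℂ) • curOpTT' L t' with hDdef
  have hD : D.IsHermitian :=
    (((isHermitian_uniformTwistTT' t' U θ).sub (hubbardTorusTT'_isHermitian L 1 t' U)).sub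
      (isHermitian_ofReal_smul (isHermitian_kinOpTT' t') _)).sub
      (isHermitian_ofReal_smul (isHermitian_curOpTT' t') _)
  have h0 : ∀ φ : Fock (Orb (FermionTorus 2 L)), star φ ⬝ᵥ (D *ᵥ φ) = 0 := by
    intro φ
    have hre : (star φ ⬝ᵥ (D *ᵥ φ)).re = 0 := by
      rw [hDdef, sub_mulVec, sub_mulVec, sub_mulVec, dotProduct_sub, dotProduct_sub,
        dotProduct_sub,
        Complex.sub_re, Complex.sub_re, Complex.sub_re, smul_mulVec, smul_mulVec,
        dotProduct_smul, dotProduct_smul, smul_eq_mul, smul_eq_mul, Complex.re_ofReal_mul,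
        Complex.re_ofReal_mul, re_uniformTwistTT'_eq_kin_cur hL]
      ring
    have him : (star φ ⬝ᵥ (D *ᵥ φ)).im = 0 := by
      simpa using hD.im_star_dotProduct_mulVec_self φ
    exact Complex.ext (by simpa using hre) (by simpa using him)
  have hpos : D.PosSemidef := PosSemidef.of_dotProduct_mulVec_nonneg hD fun φ => by rw [h0 φ]
  have hneg : (-D).PosSemidef := PosSemidef.of_dotProduct_mulVec_nonneg hD.neg fun φ => by
    rw [neg_mulVec, dotProduct_neg, h0 φ, neg_zero]
  have htr : D.trace = 0 := by
    have h1 := hpos.trace_nonneg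
    have h2 := hneg.trace_nonneg
    rw [trace_neg, neg_nonneg] at h2
    exact le_antisymm h2 h1
  have hD0 : D = 0 := hpos.trace_eq_zero_iff.1 htr
  have hsplit : uniformTwistTT' L t' U θ = D + (hubbardTorusTT' L 1 t' U +
      ((1 - Real.cos (θ / L) : ℝ) : ℂ) • kinOpTT' L t' +
      ((Real.sin (θ / L) : ℝ) : ℂ) • curOpTT' L t') := by
    rw [hDdef]; abel
  rw [hsplit, hD0, zero_add]


/-- Block (coordinate-sector) form of `uniformTwistTT'_eq_add_smul`. [cite: Watanabe2019, §2.2.3] -/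
theorem toBlock_uniformTwistTT'_eq (hL : 3 ≤ L) (t' U θ : ℝ)
    (p : Finset (Orb (FermionTorus 2 L)) → Prop) :
    (uniformTwistTT' L t' U θ).toBlock p p = (hubbardTorusTT' L 1 t' U).toBlock p p +
      ((1 - Real.cos (θ / L) : ℝ) : ℂ) • (kinOpTT' L t').toBlock p p +
      ((Real.sin (θ / L) : ℝ) : ℂ) • (curOpTT' L t').toBlock p p := by
  rw [uniformTwistTT'_eq_add_smul hL]
  ext a b
  simp only [toBlock_apply, Matrix.add_apply, Matrix.smul_apply]


end Operator

/-! ### The thermal ceiling for the `t–t'` torus -/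

section Thermal

variable {L : ℕ} [NeZero L]

/-- Falk–Bruch / Dyson–Lieb–Simon for ONE Hermitian observable (the `ι = Unit` instance of the
tree's `falkBruch_sum_le`): `Re⟨A²⟩ ≤ Re(A,A) + ½ √(β Re(A,A) Re⟨[A,[H,A]]⟩)`.
[cite: DLS1978, Thm. 3.1] -/
theorem re_gibbsState_mul_self_le_falkBruch {n : Type*} [Fintype n] [DecidableEq n]
    {H A : Matrix n n ℂ} (hH : H.IsHermitian) (hA : A.IsHermitian) {β : ℝ} (hβ : 0 ≤ β) :
    (gibbsState β H (A * A)).re ≤ (duhamel β H A A).re +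
      1 / 2 * Real.sqrt (β * (duhamel β H A A).re *
        (gibbsState β H (A * (H * A - A * H) - (H * A - A * H) * A)).re) := by
  have h := falkBruch_sum_le hH hβ (A := fun _ : Unit => A) (fun _ => hA)
  simpa using h


/-- **Thermal stiffness ≤ ½⟨kinetic⟩ − (β/2)·(current, current)_Duhamel** for the `t–t'` torus
(`L ≥ 3`, every `t', U`, `β > 0`, every coordinate sector `p`, any `ρ_s : ℝ`): if
`β ρ_s θ² ≤ log Z_p(0) − log Z_p(θ)` for `|θ| ≤ θ₀` (`θ₀ > 0`), then
`ρ_s L² ≤ Re⟨K_p⟩/2 − β/2 · Re duhamel β H_p J_p J_p` and `Re⟨J_p⟩ = 0`. Strictly sharpens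
`thermalStiffnessTT'_mul_sq_le_kinetic` (the Duhamel term is `≥ 0`,
`IsHermitian.re_duhamel_self_nonneg`). [cite: ScalapinoWhiteZhang1993, §II] -/
theorem thermalStiffnessTT'_le_kin_sub_duhamel (hL : 3 ≤ L) (t' U : ℝ) {β ρs θ₀ : ℝ}
    (hβ : 0 < β) (hθ₀ : 0 < θ₀) (p : Finset (Orb (FermionTorus 2 L)) → Prop)
    [Fintype {a // p a}] [DecidableEq {a // p a}]
    (hstiff : ∀ θ : ℝ, |θ| ≤ θ₀ → β * ρs * θ ^ 2 ≤
        Real.log (partitionFn β ((hubbardTorusTT'Flux L t' U 0).toBlock p p)).re -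
          Real.log (partitionFn β ((hubbardTorusTT'Flux L t' U θ).toBlock p p)).re) :
    ρs * (L : ℝ) ^ 2 ≤
        (gibbsState β ((hubbardTorusTT' L 1 t' U).toBlock p p)
            ((kinOpTT' L t').toBlock p p)).re / 2 -
          β / 2 * (duhamel β ((hubbardTorusTT' L 1 t' U).toBlock p p)
            ((curOpTT' L t').toBlock p p) ((curOpTT' L t').toBlock p p)).re ∧
      (gibbsState β ((hubbardTorusTT' L 1 t' U).toBlock p p)
          ((curOpTT' L t').toBlock p p)).re = 0 := by
  have hL0 : (0 : ℝ) < L := by exact_mod_cast (by omega : 0 < L)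
  rcases isEmpty_or_nonempty {a // p a} with hE | hne
  · -- empty block: all thermal quantities vanish and `ρs ≤ 0`
    have h := hstiff θ₀ (abs_of_pos hθ₀).le
    have h0 : β * ρs * θ₀ ^ 2 ≤ 0 := by simpa [partitionFn, Matrix.trace] using h
    have hρ : ρs ≤ 0 := by
      by_contra hcon
      push Not at hcon
      have h3 := mul_pos (mul_pos hβ hcon) (pow_pos hθ₀ 2)
      linarith
    have h4 : ρs * (L : ℝ) ^ 2 ≤ 0 := mul_nonpos_of_nonpos_of_nonneg hρ (sq_nonneg _)
    refine ⟨?_, ?_⟩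
    · simpa [gibbsState_apply, duhamel, partitionFn, Matrix.trace] using h4
    · simp [gibbsState_apply, Matrix.trace]
  · -- nonempty block: the generic engine with `c = 1/L`
    have hHp : ((hubbardTorusTT' L 1 t' U).toBlock p p).IsHermitian :=
      (hubbardTorusTT'_isHermitian L 1 t' U).submatrix _
    have hKp : ((kinOpTT' L t').toBlock p p).IsHermitian :=
      (isHermitian_kinOpTT' (L := L) t').submatrix _
    have hJp : ((curOpTT' L t').toBlock p p).IsHermitian :=
      (isHermitian_curOpTT' (L := L) t').submatrix _
    have hc : (L : ℝ)⁻¹ ≠ 0 := inv_ne_zero hL0.ne'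
    have hyp : ∀ θ : ℝ, |θ| ≤ θ₀ → β * ρs * θ ^ 2 ≤
        Real.log (partitionFn β ((hubbardTorusTT' L 1 t' U).toBlock p p)).re -
          Real.log (partitionFn β ((hubbardTorusTT' L 1 t' U).toBlock p p +
            ((1 - Real.cos (θ * (L : ℝ)⁻¹) : ℝ) : ℂ) • (kinOpTT' L t').toBlock p p +
            ((Real.sin (θ * (L : ℝ)⁻¹) : ℝ) : ℂ) • (curOpTT' L t').toBlock p p)).re := by
      intro θ hθ
      have h := hstiff θ hθ
      rw [hubbardTorusTT'Flux_zero, ← partitionFn_toBlock_uniformTwistTT'_eq hL t' U θ β p,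
        toBlock_uniformTwistTT'_eq hL, div_eq_mul_inv] at h
      exact h
    obtain ⟨h1, h2⟩ := stiffness_le_half_kin_sub_duhamel hHp hKp hJp hβ hθ₀ hc hyp
    refine ⟨?_, h2⟩
    rw [inv_pow, inv_mul_eq_div, le_div_iff₀ (pow_pos hL0 2)] at h1
    exact h1


/-- **Thermal current-moment (Kubo-curvature) stiffness ceiling for the `t–t'` torus** —
conjecture node, PROVED below (`thermalCurrentMomentStiffnessCeilingTT'_holds`): for `L ≥ 3`,
every `t', U`, `0 < β`, `0 < θ₀`, every coordinate sector `p` and every `ρ_s : ℝ` with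
`β ρ_s θ² ≤ log Z_p(0) − log Z_p(θ)` on `|θ| ≤ θ₀`:
`ρ_s L² ≤ Re⟨K_p⟩_{β,p}/2 − β/2 · Re duhamel β H_p J_p J_p` and `Re⟨J_p⟩_{β,p} = 0`.
[cite: ScalapinoWhiteZhang1993, §II] [cite: HazraVermaRanderia2019, eq. (2)] -/
@[conjecture] def ThermalCurrentMomentStiffnessCeilingTT' : Prop :=
  ∀ (L : ℕ) [NeZero L], 3 ≤ L → ∀ (t' U β ρs θ₀ : ℝ), 0 < β → 0 < θ₀ →
    ∀ (p : Finset (Orb (FermionTorus 2 L)) → Prop) [Fintype {a // p a}] [DecidableEq {a // p a}],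
    (∀ θ : ℝ, |θ| ≤ θ₀ → β * ρs * θ ^ 2 ≤
        Real.log (partitionFn β ((hubbardTorusTT'Flux L t' U 0).toBlock p p)).re -
          Real.log (partitionFn β ((hubbardTorusTT'Flux L t' U θ).toBlock p p)).re) →
    ρs * (L : ℝ) ^ 2 ≤
        (gibbsState β ((hubbardTorusTT' L 1 t' U).toBlock p p)
            ((kinOpTT' L t').toBlock p p)).re / 2 -
          β / 2 * (duhamel β ((hubbardTorusTT' L 1 t' U).toBlock p p)
            ((curOpTT' L t').toBlock p p) ((curOpTT' L t').toBlock p p)).re ∧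
      (gibbsState β ((hubbardTorusTT' L 1 t' U).toBlock p p)
          ((curOpTT' L t').toBlock p p)).re = 0


/-- Proof of the node `ThermalCurrentMomentStiffnessCeilingTT'`. -/
theorem thermalCurrentMomentStiffnessCeilingTT'_holds :
    ThermalCurrentMomentStiffnessCeilingTT' := by
  intro L _ hL t' U β ρs θ₀ hβ hθ₀ p _ _ hstiff
  exact thermalStiffnessTT'_le_kin_sub_duhamel hL t' U hβ hθ₀ p hstiff


/-- **Thermal current-moment ceiling with the Falk–Bruch moment bound** — conjecture node,
PROVED below (`thermalCurrentMomentFalkBruchCeilingTT'_holds`): under the hypotheses of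
`ThermalCurrentMomentStiffnessCeilingTT'`, with `H_p, K_p, J_p` the sector blocks,
(i) `ρ_s L² ≤ Re⟨K_p⟩/2 − β/2 · b`, (ii) `Re⟨J_p²⟩ ≤ b + ½ √(β b c)`, (iii) `0 ≤ b`, (iv) `0 ≤ c`,
(v) `Re⟨J_p⟩ = 0`, where `b = Re duhamel β H_p J_p J_p` and `c = Re⟨J_p[H_p,J_p] − [H_p,J_p]J_p⟩`.
[cite: DLS1978, Thm. 3.1] [cite: ScalapinoWhiteZhang1993, §II] -/
@[conjecture] def ThermalCurrentMomentFalkBruchCeilingTT' : Prop :=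
  ∀ (L : ℕ) [NeZero L], 3 ≤ L → ∀ (t' U β ρs θ₀ : ℝ), 0 < β → 0 < θ₀ →
    ∀ (p : Finset (Orb (FermionTorus 2 L)) → Prop) [Fintype {a // p a}] [DecidableEq {a // p a}],
    (∀ θ : ℝ, |θ| ≤ θ₀ → β * ρs * θ ^ 2 ≤
        Real.log (partitionFn β ((hubbardTorusTT'Flux L t' U 0).toBlock p p)).re -
          Real.log (partitionFn β ((hubbardTorusTT'Flux L t' U θ).toBlock p p)).re) →
    let Hp := (hubbardTorusTT' L 1 t' U).toBlock p p
    let Kp := (kinOpTT' L t').toBlock p p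
    let Jp := (curOpTT' L t').toBlock p p
    ρs * (L : ℝ) ^ 2 ≤ (gibbsState β Hp Kp).re / 2 - β / 2 * (duhamel β Hp Jp Jp).re ∧
      (gibbsState β Hp (Jp * Jp)).re ≤ (duhamel β Hp Jp Jp).re +
        1 / 2 * Real.sqrt (β * (duhamel β Hp Jp Jp).re *
          (gibbsState β Hp (Jp * (Hp * Jp - Jp * Hp) - (Hp * Jp - Jp * Hp) * Jp)).re) ∧
      0 ≤ (duhamel β Hp Jp Jp).re ∧
      0 ≤ (gibbsState β Hp (Jp * (Hp * Jp - Jp * Hp) - (Hp * Jp - Jp * Hp) * Jp)).re ∧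
      (gibbsState β Hp Jp).re = 0


/-- Proof of the node `ThermalCurrentMomentFalkBruchCeilingTT'`. -/
theorem thermalCurrentMomentFalkBruchCeilingTT'_holds :
    ThermalCurrentMomentFalkBruchCeilingTT' := by
  intro L _ hL t' U β ρs θ₀ hβ hθ₀ p _ _ hstiff Hp Kp Jp
  have hHp : Hp.IsHermitian := (hubbardTorusTT'_isHermitian L 1 t' U).submatrix _
  have hJp : Jp.IsHermitian := (isHermitian_curOpTT' (L := L) t').submatrix _
  obtain ⟨h1, h2⟩ := thermalStiffnessTT'_le_kin_sub_duhamel hL t' U hβ hθ₀ p hstiff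
  exact ⟨h1, re_gibbsState_mul_self_le_falkBruch hHp hJp hβ.le, hHp.re_duhamel_self_nonneg hJp β,
    hHp.re_gibbsState_doubleComm_nonneg hJp hβ.le, h2⟩


end Thermal

end Summit.HubbardSuperconductivity.HubbardLadder.Bounds
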